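import Summits.RiemannHypothesis.RiemannHypothesis.Theorems.PfPersistenceBottomVectors
import Summits.RiemannHypothesis.RiemannHypothesis.Theorems.PfPersistenceCentralMassFloor
import HarnessLib

/-!
# PF persistence — from direction cones to SIGNS: coordinates, and profiles on the window
(pub-rhpf, barrier-prover gen 3; file 2 of 3 of the rank-one-dominance / eigenvector-tolerance packet)

**HONEST FRAMING. This is a long-odds MECHANISM SEARCH; no RH claims.** RH-free finite-dimensional linear
algebra; every statement PROVED; no DATA. With the direction tolerance `SinSqLe τ u u₀` of
`PfPersistenceBottomVectors`:

* `oneSign_coords_of_sinSqLe`: a nonzero vector in the `τ`-cone of a coordinatewise-positive `u₀` with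
  `τ|u₀|² < (1 − τ)(u₀ i)²` for all `i` has ALL coordinates nonzero and of ONE sign;
* `oneSigned_of_sinSqLe` (the cell's `theta` tier): on a window of length `L > 0`, a nonzero vector in the
  `τ`-cone of a `u₀` whose PROFILE `θ_{u₀}` is one-signed with margin `m₀ > 0` (`OneSignedMargin`) has a ONE-SIGNED
  profile (`OneSigned`) once `τ|u₀|²(2N+1) < (1 − τ) m₀² L` (pointwise bound `CentralMassFloor.profile_sq_le`);
* profile linearity `profile_smul_vec`, `profile_add_vec`.

Used by `PfPersistenceRankOneDominance` (Perron–Frobenius by dominance) and by the eigenvector-tolerance walls.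
-/

set_option linter.dupNamespace false  -- the mandated namespace repeats `RiemannHypothesis`

noncomputable section

open Real Finset Matrix Set

namespace Summit.RiemannHypothesis.RiemannHypothesis.Theorems.PfPersistence

/-! ## §5 From cones to signs: coordinates, and profiles on the window -/

/-- **PROVED — A NARROW CONE AROUND A POSITIVE VECTOR IS ONE-SIGNED (coordinates).** If `u ≠ 0` lies in the
`τ`-cone of a coordinatewise-positive `u₀` and `τ|u₀|² < (1 − τ)(u₀ i)²` for every `i`, then ALL coordinates of `u`
are nonzero and of ONE sign. [folklore] -/
theorem oneSign_coords_of_sinSqLe {n : ℕ} {τ : ℝ} {u u₀ : Fin n → ℝ} (h : SinSqLe τ u u₀) (hu : u ≠ 0)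
    (hpos : ∀ i, 0 < u₀ i) (hdom : ∀ i, τ * (u₀ ⬝ᵥ u₀) < (1 - τ) * u₀ i ^ 2) :
    (∀ i, 0 < u i) ∨ (∀ i, u i < 0) := by
  have hq : 0 < u ⬝ᵥ u := dotSelf_pos_of_ne_zero hu
  set w := orthPart u u₀ with hw
  have hW : w ⬝ᵥ w ≤ τ * ((u₀ ⬝ᵥ u₀) ^ 2 * (u ⬝ᵥ u)) := orthPart_dotSelf_le_of_sinSqLe h
  have hcoord : ∀ i, (u₀ ⬝ᵥ u₀) * u i = w i + (u ⬝ᵥ u₀) * u₀ i := fun i => by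
    have := congr_fun (smul_eq_orthPart_add u u₀) i
    simpa only [Pi.smul_apply, Pi.add_apply, smul_eq_mul] using this
  have hlt : ∀ i, w i ^ 2 < ((u ⬝ᵥ u₀) * u₀ i) ^ 2 := fun i => by
    have h1 : w i ^ 2 ≤ w ⬝ᵥ w := coord_sq_le_dotSelf w i
    have hs : 0 < u₀ ⬝ᵥ u₀ := lt_of_lt_of_le (pow_pos (hpos i) 2) (coord_sq_le_dotSelf u₀ i)
    have hqs : 0 < (u ⬝ᵥ u) * (u₀ ⬝ᵥ u₀) := mul_pos hq hs
    have h4 := mul_lt_mul_of_pos_left (hdom i) hqs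
    have h2 : (1 - τ) * ((u ⬝ᵥ u) * (u₀ ⬝ᵥ u₀)) ≤ (u ⬝ᵥ u₀) ^ 2 := h
    have h5 := mul_le_mul_of_nonneg_right h2 (sq_nonneg (u₀ i))
    nlinarith [h1, hW, h4, h5]
  have hs_of : ∀ i : Fin n, 0 < u₀ ⬝ᵥ u₀ := fun i =>
    lt_of_lt_of_le (pow_pos (hpos i) 2) (coord_sq_le_dotSelf u₀ i)
  rcases lt_trichotomy (u ⬝ᵥ u₀) 0 with hneg | hzero | hpos'
  · right
    intro i
    have hs := hs_of i
    have hab := (sq_lt_sq.1 (hlt i))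
    rw [abs_of_neg (mul_neg_of_neg_of_pos hneg (hpos i))] at hab
    have hwi := (abs_lt.1 hab).2
    have hprod : (u₀ ⬝ᵥ u₀) * u i < 0 := by rw [hcoord i]; linarith
    by_contra hge
    push Not at hge
    have := mul_nonneg hs.le hge
    linarith
  · left
    intro i
    exfalso
    have := hlt i
    rw [hzero, zero_mul] at this
    nlinarith [sq_nonneg (w i)]
  · left
    intro i
    have hs := hs_of i
    have hab := (sq_lt_sq.1 (hlt i))
    rw [abs_of_pos (mul_pos hpos' (hpos i))] at hab
    have hwi := (abs_lt.1 hab).1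
    have hprod : 0 < (u₀ ⬝ᵥ u₀) * u i := by rw [hcoord i]; linarith
    exact (mul_pos_iff_of_pos_left hs).1 hprod

/-- PROVED: profiles are linear — scalars. [folklore] -/
theorem profile_smul_vec (L : ℝ) {N : ℕ} (c : ℝ) (v : Fin (N + 1) → ℝ) (x : ℝ) :
    profile L (c • v) x = c * profile L v x := by
  simp only [profile, Pi.smul_apply, smul_eq_mul, Finset.mul_sum, mul_assoc]

/-- PROVED: profiles are linear — sums. [folklore] -/
theorem profile_add_vec (L : ℝ) {N : ℕ} (v w : Fin (N + 1) → ℝ) (x : ℝ) :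
    profile L (v + w) x = profile L v x + profile L w x := by
  simp only [profile, Pi.add_apply, add_mul, Finset.sum_add_distrib]

/-- **PROVED — A NARROW CONE AROUND A MARGINED PROFILE IS ONE-SIGNED (the `theta` tier).** On a window of length
`L > 0`: if `θ_{u₀}` is one-signed with margin `m₀ > 0`, `u ≠ 0` lies in the `τ`-cone of `u₀`, and
`τ |u₀|² (2N+1) < (1 − τ) m₀² L`, then `θ_u` is ONE-SIGNED on the window. Proof: `|u₀|² θ_u = θ_w + (u·u₀) θ_{u₀}`
with `θ_w² ≤ |w|² (2N+1)/L` (`profile_sq_le`) `< ((u·u₀) θ_{u₀})²`. [folklore] -/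
theorem oneSigned_of_sinSqLe {N : ℕ} {L m₀ τ : ℝ} (hL : 0 < L) {u u₀ : Fin (N + 1) → ℝ}
    (hmar : OneSignedMargin L m₀ u₀) (hm₀ : 0 < m₀) (h : SinSqLe τ u u₀) (hu : u ≠ 0)
    (hdom : τ * (u₀ ⬝ᵥ u₀) * (2 * N + 1) < (1 - τ) * m₀ ^ 2 * L) : OneSigned L u := by
  have hq : 0 < u ⬝ᵥ u := dotSelf_pos_of_ne_zero hu
  set w := orthPart u u₀ with hw
  have hW : w ⬝ᵥ w ≤ τ * ((u₀ ⬝ᵥ u₀) ^ 2 * (u ⬝ᵥ u)) := orthPart_dotSelf_le_of_sinSqLe h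
  have hθ : ∀ x, (u₀ ⬝ᵥ u₀) * profile L u x = profile L w x + (u ⬝ᵥ u₀) * profile L u₀ x := fun x => by
    rw [← profile_smul_vec, smul_eq_orthPart_add u u₀, profile_add_vec, profile_smul_vec]
  -- the margin: θ_{u₀}(x)² ≥ m₀² on the window, with a fixed sign `σ`
  have hsq0 : ∀ x ∈ Icc (-(L / 2)) (L / 2), m₀ ^ 2 ≤ profile L u₀ x ^ 2 := fun x hx => by
    rcases hmar with hm | hm
    · have := hm x hx
      nlinarith
    · have := hm x hx
      nlinarith
  -- the key pointwise inequality θ_w(x)² < ((u·u₀) θ_{u₀}(x))² on the window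
  have hlt : ∀ x ∈ Icc (-(L / 2)) (L / 2),
      profile L w x ^ 2 < ((u ⬝ᵥ u₀) * profile L u₀ x) ^ 2 := fun x hx => by
    have h1 : profile L w x ^ 2 * L ≤ (w ⬝ᵥ w) * (2 * N + 1) := by
      have := CentralMassFloor.profile_sq_le hL w x
      rw [mul_div_assoc'] at this
      exact (le_div_iff₀ hL).1 this
    have hm2 := hsq0 x hx
    have h2 : (1 - τ) * ((u ⬝ᵥ u) * (u₀ ⬝ᵥ u₀)) ≤ (u ⬝ᵥ u₀) ^ 2 := h
    -- u₀ ≠ 0: its profile has a positive margin somewhere (x itself)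
    have hs : 0 < u₀ ⬝ᵥ u₀ := by
      rcases eq_or_ne u₀ 0 with h0 | h0
      · exfalso
        have : profile L u₀ x = 0 := by simp [profile, h0]
        rw [this] at hm2
        nlinarith
      · exact dotSelf_pos_of_ne_zero h0
    have hqs : 0 < (u ⬝ᵥ u) * (u₀ ⬝ᵥ u₀) := mul_pos hq hs
    have h4 := mul_lt_mul_of_pos_left hdom hqs
    have h5 := mul_le_mul_of_nonneg_right h2 (mul_nonneg (sq_nonneg m₀) hL.le)
    have h6 := mul_le_mul_of_nonneg_left hm2 (mul_nonneg (sq_nonneg (u ⬝ᵥ u₀)) hL.le)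
    -- chain: L θ_w² ≤ W(2N+1) ≤ τ s² q (2N+1) < (1−τ) m₀² L q s ≤ p² m₀² L ≤ p² θ₀² L
    have h7 : profile L w x ^ 2 * L < ((u ⬝ᵥ u₀) * profile L u₀ x) ^ 2 * L := by nlinarith [h1, hW, h4, h5, h6]
    exact lt_of_mul_lt_mul_right h7 hL.le
  -- sign bookkeeping
  have hsgn_pos : ∀ x ∈ Icc (-(L / 2)) (L / 2), 0 < (u ⬝ᵥ u₀) * profile L u₀ x → 0 < profile L u x := by
    intro x hx hp
    have hab := sq_lt_sq.1 (hlt x hx)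
    rw [abs_of_pos hp] at hab
    have hwx := (abs_lt.1 hab).1
    have hs : 0 < u₀ ⬝ᵥ u₀ := by
      rcases eq_or_ne u₀ 0 with h0 | h0
      · exfalso
        have : profile L u₀ x = 0 := by simp [profile, h0]
        rw [this, mul_zero] at hp
        exact lt_irrefl _ hp
      · exact dotSelf_pos_of_ne_zero h0
    have hprod : 0 < (u₀ ⬝ᵥ u₀) * profile L u x := by rw [hθ x]; linarith
    exact (mul_pos_iff_of_pos_left hs).1 hprod
  have hsgn_neg : ∀ x ∈ Icc (-(L / 2)) (L / 2), (u ⬝ᵥ u₀) * profile L u₀ x < 0 → profile L u x < 0 := by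
    intro x hx hp
    have hab := sq_lt_sq.1 (hlt x hx)
    rw [abs_of_neg hp] at hab
    have hwx := (abs_lt.1 hab).2
    have hs : 0 ≤ u₀ ⬝ᵥ u₀ := dotProduct_self_nonneg_real u₀
    have hprod : (u₀ ⬝ᵥ u₀) * profile L u x < 0 := by rw [hθ x]; linarith
    by_contra hge
    push Not at hge
    have := mul_nonneg hs hge
    linarith
  rcases lt_trichotomy (u ⬝ᵥ u₀) 0 with hneg | hzero | hpos'
  · rcases hmar with hm | hm
    · right
      intro x hx
      exact (hsgn_neg x hx (mul_neg_of_neg_of_pos hneg (lt_of_lt_of_le hm₀ (hm x hx)))).le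
    · left
      intro x hx
      exact (hsgn_pos x hx (mul_pos_of_neg_of_neg hneg (by linarith [hm x hx]))).le
  · left
    intro x hx
    exfalso
    have := hlt x hx
    rw [hzero, zero_mul] at this
    nlinarith [sq_nonneg (profile L w x)]
  · rcases hmar with hm | hm
    · left
      intro x hx
      exact (hsgn_pos x hx (mul_pos hpos' (lt_of_lt_of_le hm₀ (hm x hx)))).le
    · right
      intro x hx
      exact (hsgn_neg x hx (mul_neg_of_pos_of_neg hpos' (by linarith [hm x hx]))).le

end Summit.RiemannHypothesis.RiemannHypothesis.Theorems.PfPersistence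

end
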